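import Literature.Analysis.FluidPDE.FluidComputer.ThresholdLevelTableL
import HarnessLib

/-!
# Kernel run of the re-cut level-table checker, chunks 12 … 15 (steps 300 … 399) (bp3 gen 13)

HONEST FRAMING: low prior, high value-of-information experiment on Tao's machine paradigm; NOT a
claim that NS blows up.

Four kernel evaluations (`decide +kernel`; no `native_decide`, no extra axioms) of the checker
`runSteps` (`ThresholdLevelCheck.lean`) on 25 steps of `ThresholdLevelTableL.stepsT` at a time, from
the entry box `Bc i` towards the next chunk's first level, returning the entry box `Bc (i+1)`
(≈ 30 s of kernel time per chunk; same scheme as `ThresholdLevelTableRun0 … 7`).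
-/

namespace Literature.Analysis.FluidPDE.FluidComputer

namespace ThresholdLevelTableL

open ThresholdLevelTable (GIt RbIt)

set_option maxHeartbeats 10000000 in
set_option maxRecDepth 200000 in
/-- Chunk 12 of the re-cut table run (steps 300 … 324). [folklore] -/
theorem run12 : runSteps 60 12 3 GIt RbIt Bc12 chunk12 591746102507055 = some Bc13 := by
  decide +kernel

set_option maxHeartbeats 10000000 in
set_option maxRecDepth 200000 in
/-- Chunk 13 of the re-cut table run (steps 325 … 349). [folklore] -/
theorem run13 : runSteps 60 12 3 GIt RbIt Bc13 chunk13 670023934292796 = some Bc14 := by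
  decide +kernel

set_option maxHeartbeats 10000000 in
set_option maxRecDepth 200000 in
/-- Chunk 14 of the re-cut table run (steps 350 … 374). [folklore] -/
theorem run14 : runSteps 60 12 3 GIt RbIt Bc14 chunk14 758656576905540 = some Bc15 := by
  decide +kernel

set_option maxHeartbeats 10000000 in
set_option maxRecDepth 200000 in
/-- Chunk 15 of the re-cut table run (steps 375 … 399). [folklore] -/
theorem run15 : runSteps 60 12 3 GIt RbIt Bc15 chunk15 859013793722950 = some Bc16 := by
  decide +kernel

end ThresholdLevelTableL

end Literature.Analysis.FluidPDE.FluidComputer
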